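import Summits.QuantumFields.YangMills.Theorems.UVSeamRec.Negative.PenetrationLaplace
import Summits.QuantumFields.YangMills.Theorems.BalabanLadderNTBoundaryLawSymmetry
import HarnessLib

/-!
# Crux `UVSeamRec` (stmt-20043) / `NT` (stmt-19353): the identity exterior is classically FLAT — the reference half of
# `ClassicalPlanePenetrationAtRate` is a theorem, leaving a ONE-exterior variational statement

Refuter∕disprover seat `ym-cdisprove-19353-penetration` (R282), sequel to `PenetrationLaplace` (p531835).

* `plaquetteObs_le_N`, `wilsonBoundaryAction_nonneg`, `wilsonBoundaryAction_one` — `Re tr r.ρ(U_p) ≤ N` (unitarity), so the boundary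
  Wilson action is `≥ 0` and vanishes at the identity configuration;
* `plaquetteObs_eq_N_of_isMinOn_one` — **flatness of the ground states with identity exterior**: if `ζ` minimises the boundary Wilson
  action of `Λ` glued into the identity configuration, every plaquette touching `Λ` has `Re tr r.ρ(U_p) = N` (the minimum is `0`,
  attained at `ζ ≡ 1`, and every term is `≥ 0`);
* `mem_cubeEdges_of_two_le_depth`, `plane_eq_N_of_mem_cubeMinimisers_one` (with `NT.BoundaryLaw.plane_eq_plaquetteObs`),
  `dens_eq_dens_one_of_mem_cubeMinimisers_one` — at a site of depth `≥ 2` the plane field (resp. the action density) of every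
  identity-exterior ground state equals `r.N` (resp. its flat value `dens x 1`);
* `ClassicalPlaneDeficitAtRate ρ` / `ClassicalDensDeficitAtRate ρ` — the ONE-exterior statements the seat's numerics test: for every
  target depth a cube, a site `x` of that depth and ONE exterior `η` all of whose ground states have `plane q x ≤ r.N − gap`
  (resp. `dens x ≤ dens x 1 − gap`) with `gap > θ·ρ(depth)`;
* `classicalPlanePenetrationAtRate_of_deficit`, `classicalDensPenetrationAtRate_of_deficit` and the end-to-end corollaries
  `not_fbl6_of_classicalPlaneDeficitAtRate` (+ `_inv_sq`), `not_fbl_of_classicalDensDeficitAtRate`,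
  `not_e1osc_of_classicalDensDeficitAtRate`.

So: a coherent exterior whose every Wilson-action ground state keeps a centre plaquette angle `≥ κ/b` (`Re tr ≤ N − c κ²/b²`,
depth `≍ b/2`) for unboundedly many `b` is, by itself, `¬FBL6 ∧ ¬FBL ∧ ¬E1-osc` for every unit map `a → 0`.  Nothing here asserts
that such exteriors exist (kit jobs j279151–j279154 of this seat measure exactly this quantity); nothing about NT, E0′ or the mass gap.
No sorry; standard axioms.
-/

set_option autoImplicit false

noncomputable section

open MeasureTheory Filter Topology
open Literature.MathematicalPhysics.QuantumFieldTheory Literature.MathematicalPhysics.QuantumLattice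
open Literature.Probability.LatticeModels
open Summit.QuantumFields.YangMills.Cruxes.OSLegsFromFemtoAndGap.DlrCollarTransfer
open Summit.QuantumFields.YangMills.Cruxes.NT.BoundaryLaw (plane_eq_plaquetteObs)

namespace Summit.QuantumFields.YangMills.Cruxes.UVSeamRec.BoundaryLawPenetration

variable {G : Type} [Group G] [TopologicalSpace G] [IsTopologicalGroup G] [CompactSpace G]
  [MeasurableSpace G] [BorelSpace G] (r : LatticeRep G)

/-! ### Unitarity bound and the identity configuration -/

omit [IsTopologicalGroup G] [CompactSpace G] [MeasurableSpace G] [BorelSpace G] in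
/-- `Re tr r.ρ(U_p) ≤ N` for a unitary representation. [cite: arXiv180301950, §2] -/
theorem plaquetteObs_le_N (x : Site 4) (i j : Fin 4) (U : LGConfig 4 G) : plaquetteObs r.ρ x i j U ≤ r.N :=
  (le_abs_self _).trans (abs_plaquetteObs_le_holds r.ρ r.mem_unitary x i j U)

omit [IsTopologicalGroup G] [CompactSpace G] [MeasurableSpace G] [BorelSpace G] in
/-- At the identity configuration every plaquette observable equals `N`. [folklore] -/
theorem plaquetteObs_one (x : Site 4) (i j : Fin 4) : plaquetteObs r.ρ x i j (1 : LGConfig 4 G) = r.N := by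
  simp [plaquetteObs, plaquetteHolonomyZd, Matrix.trace_one]

omit [IsTopologicalGroup G] [CompactSpace G] [MeasurableSpace G] [BorelSpace G] in
/-- The boundary Wilson action is non-negative. [folklore] -/
theorem wilsonBoundaryAction_nonneg (Λ : Finset (Literature.MathematicalPhysics.QuantumLattice.ZdEdge 4)) (U : LGConfig 4 G) : 0 ≤ wilsonBoundaryAction r.ρ Λ U :=
  Finset.sum_nonneg fun _ _ => sub_nonneg.2 (plaquetteObs_le_N r _ _ _ _)

omit [IsTopologicalGroup G] [CompactSpace G] [MeasurableSpace G] [BorelSpace G] in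
/-- The boundary Wilson action vanishes at the identity configuration. [folklore] -/
theorem wilsonBoundaryAction_one (Λ : Finset (Literature.MathematicalPhysics.QuantumLattice.ZdEdge 4)) : wilsonBoundaryAction r.ρ Λ (1 : LGConfig 4 G) = 0 :=
  Finset.sum_eq_zero fun p _ => by rw [plaquetteObs_one, sub_self]

omit [TopologicalSpace G] [IsTopologicalGroup G] [CompactSpace G] [MeasurableSpace G] [BorelSpace G] in
/-- Gluing the identity interior into the identity exterior gives the identity configuration. [folklore] -/
theorem glueWith_one_one (Λ : Finset (Literature.MathematicalPhysics.QuantumLattice.ZdEdge 4)) : glueWith Λ (fun _ => (1 : G)) (1 : LGConfig 4 G) = 1 := by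
  funext e
  by_cases he : e ∈ Λ
  · rw [glueWith_apply_mem Λ _ _ he, Pi.one_apply]
  · rw [glueWith_apply_not_mem Λ _ _ he]

omit [IsTopologicalGroup G] [CompactSpace G] [MeasurableSpace G] [BorelSpace G] in
/-- **Ground states with identity exterior are flat on `Λ`**: if `ζ` minimises the boundary Wilson action of `Λ` glued into the
identity configuration, then every plaquette touching `Λ` has `Re tr r.ρ(U_p) = N`. [folklore] -/
theorem plaquetteObs_eq_N_of_isMinOn_one {Λ : Finset (Literature.MathematicalPhysics.QuantumLattice.ZdEdge 4)} {ζ : ↥Λ → G}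
    (hζ : ∀ ζ' : ↥Λ → G, wilsonBoundaryAction r.ρ Λ (glueWith Λ ζ 1) ≤ wilsonBoundaryAction r.ρ Λ (glueWith Λ ζ' 1))
    {p : ZdPlaquette 4} (hp : p ∈ plaquettesTouching Λ) :
    plaquetteObs r.ρ p.1 p.2.1.1 p.2.1.2 (glueWith Λ ζ 1) = r.N := by
  have h0 : wilsonBoundaryAction r.ρ Λ (glueWith Λ ζ 1) ≤ 0 := by
    have h := hζ (fun _ => 1)
    rwa [glueWith_one_one, wilsonBoundaryAction_one] at h
  have hterm : ∀ p' ∈ plaquettesTouching Λ,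
      0 ≤ (r.N : ℝ) - plaquetteObs r.ρ p'.1 p'.2.1.1 p'.2.1.2 (glueWith Λ ζ 1) :=
    fun p' _ => sub_nonneg.2 (plaquetteObs_le_N r _ _ _ _)
  have hsum : wilsonBoundaryAction r.ρ Λ (glueWith Λ ζ 1) = 0 :=
    le_antisymm h0 (wilsonBoundaryAction_nonneg r Λ _)
  unfold wilsonBoundaryAction at hsum
  have h := (Finset.sum_eq_zero_iff_of_nonneg hterm).1 hsum p hp
  linarith

/-! ### Cube geometry: a site of depth `≥ 2` carries interior plaquettes -/

/-- At depth `≥ 2` every positively oriented edge leaving `x` is an interior link of the cube. [folklore] -/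
theorem mem_cubeEdges_of_two_le_depth {c : Fin 4 → ℤ} {b : ℕ} {x : Fin 4 → ℤ} (hx : 2 ≤ depth c b x) (i : Fin 4) :
    (x, i) ∈ cubeEdges c b := by
  have h : ∀ j : Fin 4, 2 ≤ min (x j - c j + 1).toNat (c j + b - x j).toNat := fun j => by
    unfold depth at hx
    exact (Finset.le_inf'_iff _ _).1 hx j (Finset.mem_univ j)
  have h' : ∀ j : Fin 4, c j + 1 ≤ x j ∧ x j + 2 ≤ c j + b := fun j => by
    have hj := h j
    have h1 : 2 ≤ (x j - c j + 1).toNat := hj.trans (min_le_left _ _)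
    have h2 : 2 ≤ (c j + b - x j).toNat := hj.trans (min_le_right _ _)
    have h1' := Int.lt_toNat.1 (lt_of_lt_of_le one_lt_two h1)
    have h2' := Int.lt_toNat.1 (lt_of_lt_of_le one_lt_two h2)
    push_cast at h1' h2'
    constructor <;> omega
  unfold cubeEdges cubeSites
  simp only [Finset.mem_filter, Finset.mem_product, Finset.mem_univ, and_true, Fintype.mem_piFinset,
    Finset.mem_Ico, Pi.add_apply, Pi.single_apply]
  refine ⟨fun j => ?_, fun j => ?_⟩
  · obtain ⟨h1, h2⟩ := h' j
    constructor <;> omega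
  · obtain ⟨h1, h2⟩ := h' j
    split_ifs <;> constructor <;> omega

/-- The plaquette of orientation `q` based at a site of depth `≥ 2` touches the interior links of the cube. [folklore] -/
theorem mem_plaquettesTouching_cubeEdges {c : Fin 4 → ℤ} {b : ℕ} {x : Fin 4 → ℤ} (hx : 2 ≤ depth c b x)
    (q : {p : Fin 4 × Fin 4 // p.1 < p.2}) : ((x, q) : ZdPlaquette 4) ∈ plaquettesTouching (cubeEdges c b) :=
  mem_plaquettesTouching_iff.2 ⟨(x, q.1.1), Finset.mem_inter.2
    ⟨by simp [plaquetteEdges], mem_cubeEdges_of_two_le_depth hx _⟩⟩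

omit [TopologicalSpace G] [IsTopologicalGroup G] [CompactSpace G] [BorelSpace G] in
/-- Translating the identity configuration gives the identity configuration. [folklore] -/
theorem configShift_one (v : Site 4) : configShift v (1 : LGConfig 4 G) = 1 := by
  funext e
  rw [Literature.MathematicalPhysics.QuantumLattice.configShift_apply]
  rfl

omit [IsTopologicalGroup G] [CompactSpace G] [BorelSpace G] in
/-- **Identity exterior ⇒ flat centre (plane).**  In every ground state of the cube `(c, b)` with the identity exterior, the plane
field of any orientation `i < j` at a site of depth `≥ 2` equals `N`. [folklore] -/
theorem plane_eq_N_of_mem_cubeMinimisers_one {c : Fin 4 → ℤ} {b : ℕ} {x : Fin 4 → ℤ} (q : Fin 4 × Fin 4) (hq : q.1 < q.2)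
    (hx : 2 ≤ depth c b x) {ζ : ↥(cubeEdges c b) → G} (hζ : ζ ∈ cubeMinimisers G r c b 1) :
    plane G r q x (glueWith (cubeEdges c b) ζ 1) = r.N := by
  rw [plane_eq_plaquetteObs G r]
  have hζ' : ∀ ζ' : ↥(cubeEdges c b) → G, wilsonBoundaryAction r.ρ (cubeEdges c b) (glueWith (cubeEdges c b) ζ 1) ≤
      wilsonBoundaryAction r.ρ (cubeEdges c b) (glueWith (cubeEdges c b) ζ' 1) := fun ζ' => hζ ζ'
  exact plaquetteObs_eq_N_of_isMinOn_one r hζ' (p := (x, ⟨q, hq⟩)) (mem_plaquettesTouching_cubeEdges hx ⟨q, hq⟩)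

/-- **Identity exterior ⇒ flat centre (density).**  In every ground state of the cube with the identity exterior, the action
density at a site of depth `≥ 2` equals its flat value `dens x 1` (`= Σ_{i<j} N`). [folklore] -/
theorem dens_eq_dens_one_of_mem_cubeMinimisers_one {c : Fin 4 → ℤ} {b : ℕ} {x : Fin 4 → ℤ} (hx : 2 ≤ depth c b x)
    {ζ : ↥(cubeEdges c b) → G} (hζ : ζ ∈ cubeMinimisers G r c b 1) :
    dens G r x (glueWith (cubeEdges c b) ζ 1) = dens G r x 1 := by
  show actionDensity r.ρ (configShift (-x) (glueWith (cubeEdges c b) ζ 1)) = actionDensity r.ρ (configShift (-x) 1)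
  unfold actionDensity
  refine Finset.sum_congr rfl fun i _ => Finset.sum_congr rfl fun j _ => ?_
  by_cases hij : i < j
  · simp only [hij, if_true]
    have h1 : plane G r (i, j) x (glueWith (cubeEdges c b) ζ 1) = r.N := plane_eq_N_of_mem_cubeMinimisers_one r (i, j) hij hx hζ
    unfold plane at h1
    rw [h1, configShift_one, plaquetteObs_one]
  · simp only [hij, if_false]

/-! ### One-exterior classical statements and the end-to-end corollaries -/

variable (G)

/-- **Classical plane deficit at rate `ρ`** (one exterior).  An orientation `q`, a floor `θ > 0`, and for every target depth
`d₀ ≥ 1` a cube `(c, b)`, a site `x` of depth `≥ max d₀ 2`, ONE exterior `η` and a level `t` with `θ·ρ(depth) < N − t` such that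
every ground state of the cube with exterior `η` has `plane q x ≤ t`.  (Candidate: coherent single-plane / self-dual abelian flux
`Φ ≍ π²·k` through the cube, `x` the centre, `N − t ≍ (interior plateau angle)²`.) -/
def ClassicalPlaneDeficitAtRate (ρ : ℕ → ℝ) : Prop :=
  ∃ (q : Fin 4 × Fin 4) (θ : ℝ), q.1 < q.2 ∧ 0 < θ ∧ ∀ d₀ : ℕ, 1 ≤ d₀ →
    ∃ (c : Fin 4 → ℤ) (b : ℕ) (x : Fin 4 → ℤ) (η : LGConfig 4 G) (t : ℝ),
      d₀ ≤ depth c b x ∧ 2 ≤ depth c b x ∧ θ * ρ (depth c b x) < r.N - t ∧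
      ∀ ζ ∈ cubeMinimisers G r c b η, plane G r q x (glueWith (cubeEdges c b) ζ η) ≤ t

/-- **Classical density deficit at rate `ρ`** (one exterior; flat reference value `dens x 1`). -/
def ClassicalDensDeficitAtRate (ρ : ℕ → ℝ) : Prop :=
  ∃ θ : ℝ, 0 < θ ∧ ∀ d₀ : ℕ, 1 ≤ d₀ →
    ∃ (c : Fin 4 → ℤ) (b : ℕ) (x : Fin 4 → ℤ) (η : LGConfig 4 G) (t : ℝ),
      d₀ ≤ depth c b x ∧ 2 ≤ depth c b x ∧ θ * ρ (depth c b x) < dens G r x 1 - t ∧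
      ∀ ζ ∈ cubeMinimisers G r c b η, dens G r x (glueWith (cubeEdges c b) ζ η) ≤ t

variable {G r}

omit [IsTopologicalGroup G] [CompactSpace G] [BorelSpace G] in
/-- One exterior suffices: the identity exterior supplies the reference half. [folklore] -/
theorem classicalPlanePenetrationAtRate_of_deficit {ρ : ℕ → ℝ} (h : ClassicalPlaneDeficitAtRate G r ρ) :
    ClassicalPlanePenetrationAtRate G r ρ := by
  obtain ⟨q, θ, hq, hθ, hfam⟩ := h
  refine ⟨q, θ, hq, hθ, fun d₀ hd₀ => ?_⟩
  obtain ⟨c, b, x, η, t, hd, h2, hgap, hle⟩ := hfam d₀ hd₀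
  exact ⟨c, b, x, η, 1, t, r.N, hd, h2, hgap, hle, fun ζ hζ => (plane_eq_N_of_mem_cubeMinimisers_one r q hq h2 hζ).ge⟩

/-- One exterior suffices (density). [folklore] -/
theorem classicalDensPenetrationAtRate_of_deficit {ρ : ℕ → ℝ} (h : ClassicalDensDeficitAtRate G r ρ) :
    ClassicalDensPenetrationAtRate G r ρ := by
  obtain ⟨θ, hθ, hfam⟩ := h
  refine ⟨θ, hθ, fun d₀ hd₀ => ?_⟩
  obtain ⟨c, b, x, η, t, hd, h2, hgap, hle⟩ := hfam d₀ hd₀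
  exact ⟨c, b, x, η, 1, t, dens G r x 1, hd, h2, hgap, hle, fun ζ hζ => (dens_eq_dens_one_of_mem_cubeMinimisers_one r h2 hζ).ge⟩

section Corollaries

variable [SecondCountableTopology G]

/-- A one-exterior classical plane deficit at any rate with `ρ(n)·n⁴ → ∞` refutes `FBL6` for every unit map `a → 0`. [folklore] -/
theorem not_fbl6_of_classicalPlaneDeficitAtRate {ρ : ℕ → ℝ}
    (hρ : Tendsto (fun n : ℕ => ρ n * (n : ℝ) ^ 4) atTop atTop) (h : ClassicalPlaneDeficitAtRate G r ρ)
    (a : ℝ → ℝ) (hlim : Tendsto a atTop (𝓝 0)) : ¬ FBL6 G r a :=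
  not_fbl6_of_classicalPlanePenetrationAtRate hρ (classicalPlanePenetrationAtRate_of_deficit h) a hlim

/-- The seat's target in its sharpest classical form: an interior-flux PLATEAU under ONE coherent exterior (`ρ = 1/n²`) refutes
`FBL6` for every unit map `a → 0`. [folklore] -/
theorem not_fbl6_of_classicalPlaneDeficit_inv_sq (h : ClassicalPlaneDeficitAtRate G r fun n => 1 / (n : ℝ) ^ 2)
    (a : ℝ → ℝ) (hlim : Tendsto a atTop (𝓝 0)) : ¬ FBL6 G r a :=
  not_fbl6_of_classicalPlaneDeficitAtRate tendsto_inv_sq_mul_pow_four h a hlim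

/-- Density version: refutes `FBL` for every unit map `a → 0`. [folklore] -/
theorem not_fbl_of_classicalDensDeficitAtRate {ρ : ℕ → ℝ}
    (hρ : Tendsto (fun n : ℕ => ρ n * (n : ℝ) ^ 4) atTop atTop) (h : ClassicalDensDeficitAtRate G r ρ)
    (a : ℝ → ℝ) (hlim : Tendsto a atTop (𝓝 0)) : ¬ FBL G r a :=
  not_fbl_of_classicalDensPenetrationAtRate hρ (classicalDensPenetrationAtRate_of_deficit h) a hlim

/-- Density version: refutes the E1-osc clause (clause 1 of the 19353 stub `stub_refpkgT`) for every unit map `a → 0`, every `C₁`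
and every `ℓ > 0`. [folklore] -/
theorem not_e1osc_of_classicalDensDeficitAtRate {ρ : ℕ → ℝ}
    (hρ : Tendsto (fun n : ℕ => ρ n * (n : ℝ) ^ 4) atTop atTop) (h : ClassicalDensDeficitAtRate G r ρ)
    (a : ℝ → ℝ) (hlim : Tendsto a atTop (𝓝 0)) (C₁ ℓ : ℝ) (hℓ : 0 < ℓ) :
    ¬ ∃ β₁ : ℝ, ∀ β : ℝ, β₁ ≤ β → ∀ (c : Fin 4 → ℤ) (b : ℕ), (b : ℝ) * a β ≤ ℓ →
      ∀ (η η' : LGConfig 4 G) (x : Fin 4 → ℤ), 1 ≤ depth c b x →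
        |kerE G r β c b η (dens G r x) - kerE G r β c b η' (dens G r x)| ≤ C₁ / (depth c b x : ℝ) ^ 4 :=
  not_e1osc_of_classicalDensPenetrationAtRate hρ (classicalDensPenetrationAtRate_of_deficit h) a hlim C₁ ℓ hℓ

end Corollaries

end Summit.QuantumFields.YangMills.Cruxes.UVSeamRec.BoundaryLawPenetration

end
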